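import Summits.PneNP.PneNP.Theorems.SupportRectangleBlockLiftUDISJ
import HarnessLib

/-!
# The unique-disjointness matrix has ONE psd block of size `n + 1` (sharpness of the block regime; cell pnp-psdrank, eng g5)

Companion to `SupportRectangleBlockLift.udisj_blockPsd` (every `(S^b_+)^m` factorization of
`UDISJ(n) = ((1 − |a ∩ c|)²)_{a,c ⊆ [n]}` has `(3/2)^{n/(b+1)} ≤ m · 14400 b⁵ n⁶`, so polynomially many blocks force a
block of dimension `Ω(n / log n)`): the regime is sharp up to the logarithm, because `UDISJ(n)` is the entrywise SQUARE
of the rank-`(n+1)` matrix `1 − aᵀc` and hence has a psd factorization with a SINGLE block of size `n + 1`: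
`(1 − |a ∩ c|)² = ⟨x_a x_aᵀ, y_c y_cᵀ⟩` with `x_a = (1, 1_a)`, `y_c = (1, −1_c) ∈ ℝ^{n+1}`
(`udisj_hasPsdFactorization`). This is the standard example separating psd rank from nonnegative rank
(`rk₊(UDISJ(n)) ≥ (3/2)^n`, Kaibel–Weltge) [cite: FawziParrilo2013, §1.2 and §2 (Def. 3)]; it is recorded here so that the
«WHAT THIS IS NOT» line of the block theorem (no bound on general psd rank) is a theorem of the tree rather than prose.
Nothing here is P ≠ NP-relevant.
-/

set_option linter.dupNamespace false -- `Summit.PneNP.PneNP.…`: summit = sub-problem (D-0017)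

noncomputable section

open scoped Classical MatrixOrder

open Finset Real Matrix Literature.Combinatorics.Optimization

namespace Summit.PneNP.PneNP.Theorems.SupportRectangleBlockLift

variable {n : ℕ}

/-- The row vector `x_a = (1, 1_a) ∈ ℝ^{n+1}`. -/
def rowVec (a : Finset (Fin n)) : Fin (n + 1) → ℝ :=
  Fin.cases 1 fun i => if i ∈ a then 1 else 0

/-- The column vector `y_c = (1, −1_c) ∈ ℝ^{n+1}`. -/
def colVec (c : Finset (Fin n)) : Fin (n + 1) → ℝ :=
  Fin.cases 1 fun i => if i ∈ c then -1 else 0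

/-- `⟨x_a, y_c⟩ = 1 − |a ∩ c|`. -/
theorem rowVec_dotProduct_colVec (a c : Finset (Fin n)) :
    rowVec a ⬝ᵥ colVec c = 1 - ((a ∩ c).card : ℝ) := by
  unfold rowVec colVec dotProduct
  rw [Fin.sum_univ_succ]
  simp only [Fin.cases_zero, Fin.cases_succ, mul_one]
  have h1 : ∀ i : Fin n, (if i ∈ a then (1 : ℝ) else 0) * (if i ∈ c then -1 else 0) =
      -(if i ∈ a ∩ c then 1 else 0) := by
    intro i
    by_cases ha : i ∈ a <;> by_cases hc : i ∈ c <;> simp [ha, hc]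
  simp_rw [h1]
  rw [sum_neg_distrib, sum_boole, filter_mem_eq_inter, univ_inter]
  ring

/-- `tr(x xᵀ · y yᵀ) = ⟨x, y⟩²` for real vectors. -/
theorem trace_vecMulVec_mul_vecMulVec' {m : ℕ} (x y : Fin m → ℝ) :
    (vecMulVec x x * vecMulVec y y).trace = (x ⬝ᵥ y) ^ 2 := by
  have h : ∀ i, (vecMulVec x x * vecMulVec y y) i i = ∑ j, x i * x j * (y j * y i) := by
    intro i
    rw [Matrix.mul_apply]
    exact sum_congr rfl fun j _ => by rw [vecMulVec_apply, vecMulVec_apply]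
  unfold Matrix.trace
  simp only [Matrix.diag_apply, h]
  rw [sq, dotProduct, sum_mul_sum]
  exact sum_congr rfl fun i _ => sum_congr rfl fun j _ => by ring

/-- **`UDISJ(n)` has a psd factorization of size `n + 1`** (one block): `(1 − |a ∩ c|)² = tr(x_a x_aᵀ · y_c y_cᵀ)`.
Together with `udisj_blockPsd` (polynomially many blocks force a block of dimension `Ω(n/log n)`): the block regime
of the support-rectangle theorem is sharp up to the logarithm, and the theorem says nothing about general psd rank.
[cite: FawziParrilo2013, §2 (Def. 3 and the remark on psd rank)] -/
theorem udisj_hasPsdFactorization : HasPsdFactorization (udisj n) (n + 1) := by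
  refine ⟨fun a => vecMulVec (rowVec a) (rowVec a), fun c => vecMulVec (colVec c) (colVec c),
    fun a => ?_, fun c => ?_, fun a c => ?_⟩
  · simpa using posSemidef_vecMulVec_self_star (rowVec a)
  · simpa using posSemidef_vecMulVec_self_star (colVec c)
  · rw [trace_vecMulVec_mul_vecMulVec', rowVec_dotProduct_colVec]
    rfl

/-- In block language: `UDISJ(n)` is ONE pairing of psd `(n+1) × (n+1)` blocks (`m = 1`, `b = n + 1`), the shape
excluded by `udisj_blockPsd` only when `(3/2)^{n/(b+1)} > 14400 b⁵ n⁶`, i.e. for `b ≲ n/(30 log n)`. -/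
theorem udisj_oneBlock :
    ∃ (A B : Finset (Fin n) → Fin 1 → Matrix (Fin (n + 1)) (Fin (n + 1)) ℝ),
      (∀ a i, (A a i).PosSemidef) ∧ (∀ c i, (B c i).PosSemidef) ∧
        ∀ a c, udisj n a c = ∑ i, (A a i * B c i).trace := by
  obtain ⟨A, B, hA, hB, hfac⟩ := (udisj_hasPsdFactorization (n := n))
  exact ⟨fun a _ => A a, fun c _ => B c, fun a _ => hA a, fun c _ => hB c, fun a c => by
    rw [Fintype.sum_unique]; exact hfac a c⟩

end Summit.PneNP.PneNP.Theorems.SupportRectangleBlockLift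

end
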